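import Mathlib
import HarnessLib
import HarnessLib.Audit
import Summits.CriticalPhenomena.Statement
import Summits.CriticalPhenomena.PercolationContinuityZ3.Theorems.PercNearOneGluingNoHeavyLowerTailGlue
import Summits.CriticalPhenomena.PercolationContinuityZ3.Theorems.PercNearOneGluingKNSlabBridge
import Summits.CriticalPhenomena.PercolationContinuityZ3.Theorems.PercNearOneGluingAssembly

/-!
Route: PercNearOneGluingNoHeavy

CLOSED (closed) 2026-08-20T12:42:35Z by operator:999:1185004 — reason: closed by p205010 (crux stmt-CriticalPhenomena-4575 proved, PercNearOneGluingNoHeavyLowerTailCSHTheoremOne) / p205530 (crux 4576); every wanted item closed/proved; coordinator decision 2026-08-20 — note: closed by p205010 (crux stmt-CriticalPhenomena-4575 proved, PercNearOneGluingNoHeavyLowerTailCSHTheoremOne) / p205530 (crux 4576); every wanted item closed/proved; coordinator decision 2026-08-20. The file is kept as the record of this route; refuted decls are indexed as negative knowledge (`ledger negatives`).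

# Route PercNearOneGluingNoHeavy — Kozma–Nitzan near-one gluing through the lower-tail engine alone
(sibling of PercNearOneGluing, NoHeavyLowerTail load-bearing)

It suffices to show X = NearOneGluing, Kozma–Nitzan's Conjecture 3 (arXiv:2401.12397, p.15) typed
over ALL finite
weighted graphs (vertices Fin n, weights w, measure prodBernoulli w, events openConn): for every ε >
0 there is δ > 0
such that P(o ↔ A) > 1 − δ and P(a ↔ b) > 1 − δ for every a ∈ A force P(o ↔ b) > 1 − ε, uniformly in
|A|. This is the
SAME thesis as route PercNearOneGluing (cards kn-near-one-gluing, spine; kn-treewidth-laboratory);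
the two routes are
SIBLINGS by coordinator/gate4 ruling 2026-08-17 (one deciding theorem per route, no disjunctive
glue): there X is
reached from the finitely-refutable engine AdditiveGluing, HERE from the lower-tail engine
NoHeavyLowerTail, so that each
route's cone carries exactly one open engine. The two OPEN items are SHARED with PercNearOneGluing
(identical statements,
ledger dedup: NoHeavyLowerTail stmt-CriticalPhenomena-4575, NearOneGluing stmt-4574); the PROVED
pieces of the sibling enter BY NAME, not as
re-filed items (closed items do not dedup across routes): the bridge KNSlabBridge (stmt-10357,
Theorems.KNSlabBridge_proof) and
the glue NoHeavyLowerTail → NearOneGluing (stmt-14716, Theorems.noHeavyLowerTailGlue_proof), both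
imported by this route file. The
deciding theorem has ONE hypothesis, the engine: `closes (h_NoHeavy : NoHeavyLowerTail) :
PercolationContinuityZ3 := have hX :
NearOneGluing := Theorems.noHeavyLowerTailGlue_proof h_NoHeavy; have hA : Assembly := fun hX' =>
Theorems.percNearOneGluing_assembly_proof
Theorems.KNSlabBridge_proof hX'; hA hX` — the sibling's PROVED glue, PROVED Assembly (stmt-4580) and
PROVED bridge applied by name (the
sibling decls are definitionally the shared ones, Lean-checked), and this route's Assembly item :=
NearOneGluing → PercolationContinuityZ3
('X decides the conjunct', the sibling's Assembly with its proved bridge discharged; provable now by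
the same one line) proved INSIDE
`closes` rather than assumed, so that the only open load-bearing binder is the engine (an open
binder of shape `… → conjunct` would be a
consequence of the Statement).
Lean: `∀ ε : ℝ, 0 < ε → ∃ δ : ℝ, 0 < δ ∧ ∀ (n : ℕ) (w : Sym2 (Fin n) → unitInterval) (A : Finset
(Fin n)) (o b : Fin n), 1 - δ < (Literature.Probability.LatticeModels.prodBernoulli w).real (⋃ a ∈
A, Literature.Probability.Percolation.openConn o a) → (∀ a ∈ A, 1 - δ <
(Literature.Probability.LatticeModels.prodBernoulli w).real
(Literature.Probability.Percolation.openConn a b)) → 1 - ε <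
(Literature.Probability.LatticeModels.prodBernoulli w).real
(Literature.Probability.Percolation.openConn o b)`

## Assembly
Pure logic on proved facts, as in the sibling. The Assembly ITEM is `NearOneGluing →
PercolationContinuityZ3` (X decides the conjunct):
the sibling's PROVED Assembly (stmt-CriticalPhenomena-4580,
Theorems.percNearOneGluing_assembly_proof — if θ(p_c) > 0 the bridge fed with X
gives a slab percolating at p_c(Z³), contradicting Duminil-Copin–Sidoravicius–Tassion 2016 via
percolationContinuity_of_samePSlab) with its
bridge hypothesis discharged by the PROVED KNSlabBridge (stmt-10357, Theorems.KNSlabBridge_proof; KN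
Thm 6 at d = 3); one-line proof
`fun hX => Theorems.percNearOneGluing_assembly_proof Theorems.KNSlabBridge_proof hX` (NearOneGluing
here and there are definitionally
equal). It is a new item only because closed items do not dedup across routes, and it is NOT a
hypothesis of the deciding theorem — `closes`
proves it inline and applies it to X := Theorems.noHeavyLowerTailGlue_proof h_NoHeavy:
`closes (h_NoHeavy : NoHeavyLowerTail) : PercolationContinuityZ3 := have hX : NearOneGluing :=
…noHeavyLowerTailGlue_proof h_NoHeavy;
have hA : Assembly := fun hX' => …percNearOneGluing_assembly_proof …KNSlabBridge_proof hX'; hA hX`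
(zero sorry; axioms propext,
Classical.choice, Quot.sound; scratch_glue5.lean). Open load-bearing leaf of the cone:
NoHeavyLowerTail alone (route PercNearOneGluing after
today's re-glue: AdditiveGluing alone).

Rationale: WHY THIS LINE. Kozma–Nitzan (KozmaNitzan2024, arXiv:2401.12397 §1 approach (1), §4, Thm 6) isolate
the one finite-graph inequality
(Conjecture 3 = X) missing from the same-p one-step renormalisation of Barsky–Grimmett–Newman /
Grimmett–Marstrand and
prove X ⇒ θ(p_c) = 0 on Z^d, d ≥ 2; the bridge (KNSlabBridge, = KN Thm 6 at d = 3 in slab form) and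
the assembly
(percolationContinuity_iff_samePSlab_holds with DuminilCopinSidoraviciusTassion2016_holds) are
PROVED in the tree, so X
alone decides the conjunct. The lever of THIS sibling is the lower-tail reformulation: by Harris
(increasing × decreasing)
and Markov, E[N; o ↮ b] ≤ δ·E N for N = |C(o) ∩ A|, so X can fail only through a heavy LOWER tail of
N given a
(1−δ)-reliable relay set ('pocket with few fingers'); NoHeavyLowerTail states exactly that this does
not happen, and
NoHeavyLowerTail → X is landed (noHeavyLowerTailSuffices_proof / noHeavyLowerTailGlue_proof,
Harris1960 transported to
prodBernoulli). The tree also proves the converse chain X → ManyFingersLargePocket →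
NoHeavyLowerTail
(Theorems.manyFingersLargePocket_of_nearOneGluing,
Theorems.noHeavyLowerTail_of_manyFingersLargePocket), so the engine is
tree-equivalent to X and cannot be false unless KN Conjecture 3 is; what it buys is the attack
surface: no b appears, the
object is the law of N, and the N = 1 slice is already a theorem (Theorems.nhlt_singleFingerHub,
from BHK2006 cluster
conditional positive association). Imported areas: finite-graph correlation inequalities
(Harris/FKG, van den
Berg–Häggström–Kahn VandenbergHaggstromKahn2005 = Lean prefix BHK2006, decision trees
Gladkov2024/GladkovZimin2024), local-modification bookkeeping
(AizenmanKestenNewmanCMP1987). Relative to the sibling route nothing new is claimed except the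
separation of engines.

RANKED CRUXES. #2 NoHeavyLowerTail (crux) — ENGINE, load-bearing here (shared item
stmt-CriticalPhenomena-4575): for every ε > 0 there is δ > 0 such that on every finite weighted
graph, if P(o ↔ A) > 1 − δ and P(a ↔ a′) > 1 − δ for all a, a′ ∈ A, then P(1 ≤ N < (δ/ε)·E N) < ε,
where N = |C(o) ∩ A| and E N = Σ_a P(o ↔ a). Sufficient for X by the landed glue NoHeavyLowerTail →
NearOneGluing (stmt-14716) and, by the landed converse chain through ManyFingersLargePocket,
tree-equivalent to X. [difficulty: open-problem] (why it might fail: Tree-equivalent to KN Conj 3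
(open for its authors beyond |A|=2 / special |A|=3); a gadget family with bimodal N (chains/trees of
near-cliques sharing bottlenecks) would refute it; the LINEAR inclusive form is already false on Fin
5 (linearLowerTailInclusive_cex_five).) [KozmaNitzan2024, Harris1960, Gladkov2024,
AizenmanKestenNewmanCMP1987, VandenbergHaggstromKahn2005]
#3 NearOneGluing (crux) — X itself (shared item stmt-CriticalPhenomena-4574) — Kozma–Nitzan
Conjecture 3 over finite weighted graphs: ∀ ε > 0 ∃ δ > 0, P(o ↔ A) > 1 − δ and (∀ a ∈ A, P(a ↔ b) >
1 − δ) imply P(o ↔ b) > 1 − ε; the whole content is uniformity in |A|. In this route it is DERIVED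
inside `closes` from NoHeavyLowerTail through the landed glue, and it is the antecedent of the
proved Assembly. [deps: NoHeavyLowerTail] [difficulty: open-problem] (why it might fail: Open even
for its authors (KN p.3: Conj 1 'not able to prove or disprove'; only |A|=2 and a special |A|=3
settled); plausible general-graph inequalities fail by gadgets (bunkbed, arXiv:2410.02545); a family
with E N ≥ ε/δ and bimodal N refutes it.) [KozmaNitzan2024,
Literature.Probability.Percolation.KozmaNitzan2024_conjecture3, GladkovPakZimin2024, Gladkov2024,
GladkovZimin2024]

TWO-LAYER PLAN. Nothing filed here. NoHeavyLowerTail keeps its registered lines and crux workfiles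
(Cruxes/NoHeavyLowerTail/: PICKED.md,
Lines/, Disproof.lean, STRATEGY-CENSUS.md) and its landed sub-goal ManyFingersLargePocket →
NoHeavyLowerTail
(Theorems.noHeavyLowerTail_of_manyFingersLargePocket); any split is the strategist's / tenure
planner's on the shared item.

KILL CRITERIA. A refutation of NoHeavyLowerTail closes THIS route `refuted:NoHeavyLowerTail` (it is
the only open leaf with content) and, through the
landed chain X → NoHeavyLowerTail, refutes X and the sibling PercNearOneGluing as well (KN programme
dead in every
dimension). A refutation of AdditiveGluing does not touch this route. PercolationContinuityZ3 proved
elsewhere moots it.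

NOT DECOMPOSED YET. Everything below NoHeavyLowerTail (finger surgery / pocket-size gluing /
block-star exchange lines already landing as
`--supports stmt-CriticalPhenomena-4575` theorems); constants δ(ε); no ¬X item (refuters close the
crux by its negation).

CHEAPEST FALSIFIER. Already run against the engine's sharper forms: the LINEAR inclusive lower-tail
form is FALSE on 5 vertices
(Theorems/PercNearOneGluingNoHeavyLowerTailLinearInclusiveCex.lean,
linearLowerTailInclusive_cex_five) and the linear
form is tight (Theorems/NoHeavyLowerTail/Negative/LinearFormTight.lean); the ε–δ crux survives both.
Next cheapest: the
certified exact sweep of the KN ratio / lower-tail mass over all connected graphs on 8–9 vertices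
with weights in
{1/4,1/2,3/4} (kit, hours) — one bimodal-N family iterated under blow-up kills the crux.

NUMBERS. KN Lemma 10 cascade ε_conj3 = ε/2, δ = ε·δ_conj3/12 (pp.17, 21); glue constants δ =
min(δ₀/2, ε/3), t = 3δ₀·E N/ε
(noHeavyLowerTailSuffices_proof); p_c(Z³, bond) ≈ 0.2488 (only 0 < p_c < 1 used). Items at open: 3
(2 cruxes shared with PercNearOneGluing,
1 provable-now assembly proved inline in closes); open load-bearing binders of closes: 1
(NoHeavyLowerTail).

DEFINITION REQUESTS. None.

Novelty: Searches (2026-08-17, this seat): none new — this is a coordinator-mandated SIBLING of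
route-CriticalPhenomena-PercNearOneGluing
(gate4 ruling: one deciding theorem per route; the two-engine closes of rev 5 made both engines
jointly load-bearing), so
its prior-art record is the sibling's (searches 2026-08-15: arXiv:2401.12397 pp.1–4, 15–27, 32–37
read; arXiv:2408.08457
read; lit citing arxiv:2401.12397 → 0; lit frontier CriticalPhenomena --since 2024 → no KN
follow-up; lit galaxy search
"Kozma Nitzan conjectured inequality" --star all → 0; refuter novelty audit of the card 2026-08-15
with the same null
result); litpack route-CriticalPhenomena-PercNearOneGluing.json (built 2026-08-17T15:24Z) read — no
relevant hit beyond
the sources already cited.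
Nearest prior art found: KozmaNitzan2024 (arXiv:2401.12397) Conj 3 / Thm 6; arXiv:2408.08457 Thm 1.3
(three-point ε–δ
dichotomy); in-tree: route-CriticalPhenomena-PercNearOneGluing (same thesis, AdditiveGluing engine).
Delta: relative to the literature, the lower-tail reformulation of Conjecture 3 (Harris + Markov
residual, proved
equivalent in the tree) as the attack surface; relative to the sibling route, none beyond engine
separation (expected
grade: variant of PercNearOneGluing by construction).
Claimed grade: variant  [refs: 2401.12397, 2408.08457, arxiv:2401.12397, KozmaNitzan2024]

Barriers (technique_class: finite-graph-gluing-inequality, same-p-renormalisation): - technique_class: finite-graph-gluing-inequality, same-p-renormalisation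
- Literature.Barriers.CriticalPhenomena.SprinklingRenormalisation: not evaded but discharged
conditionally on X — KN Thm 6 is the same-p (η = 0) one-step renormalisation whose missing
inequality is Conjecture 3; the proved Assembly instantiates the barrier file's own lemma
percolationContinuity_of_samePSlab, so the barrier is met at the one place the literature says it
can be (the bet is X, here in its lower-tail form).
- Literature.Barriers.CriticalPhenomena.TransverseCrossingsNeedNotMeet: evaded in form — connections
are glued at shared VERTICES a ∈ A and, in KN Lemma 10, at seeds whose edges into the target are
open; no step infers that two transverse crossings of a box meet.
- Literature.Barriers.CriticalPhenomena.SpanningClustersAboveSix: KN's block events carry uniqueness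
(Lemma 7) as the barrier demands, and θ(p_c) = 0 is claimed for all d ≥ 2 including d > 6 where it
is true (Hara; Fitzner–van der Hofstad) — no tension.
- Literature.Barriers.CriticalPhenomena.RandomClusterFirstOrder: the line is not q-uniform; the q =
1 inputs (Harris, BHK conditional association, independent local modification) are exactly what
fails for q > 1.
- Literature.Barriers.CriticalPhenomena.TreesPercolatingAtCriticality: X is a statement about
near-one connection probabilities on FINITE graphs and the bridge uses the Z³ geometry (slabs,
symmetries); nothing is claimed for trees, where θ(p_c) = 0 holds anyway.
- Litera

History (route lifecycle, newest last):
- 2026-08-20T12:42:36Z · CLOSED closed — closed by p205010 (crux stmt-CriticalPhenomena-4575 proved, PercNearOneGluingNoHeavyLowerTailCSHTheoremOne) / p205530 (crux 4576); every wanted item closed/proved; coordinator decision 2026-08-20 (operator:999:1185004)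

sub-problem: PercolationContinuityZ3 · status: closed(closed) · opened planner-rtask-CriticalPhenomena-PercNearOneG-461c9472-0 2026-08-17T19:20:16Z · rev 0 · ledger route-CriticalPhenomena-PercNearOneGluingNoHeavy
GENERATED by the gate from the ledger (D-0016/17). Provers cite these decls: `theorem foo : Summit.CriticalPhenomena.PercolationContinuityZ3.Theses.PercNearOneGluingNoHeavy.<Decl> := …` in Summits/CriticalPhenomena/PercolationContinuityZ3/Theorems/<Name>.lean.
-/

namespace Summit.CriticalPhenomena.PercolationContinuityZ3.Theses.PercNearOneGluingNoHeavy

open scoped BigOperators Topology Manifold Classical MeasureTheory ProbabilityTheory Matrix InnerProductSpace ComplexConjugate ContinuousMap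
open Filter Set Function TopologicalSpace MeasureTheory

attribute [summit_statement] _root_.PercolationContinuityZ3

/-- item stmt-CriticalPhenomena-4575 · crux · rank 2 · closed · proved by Summit.CriticalPhenomena.PercolationContinuityZ3.Theorems.CSH.noHeavyLowerTail_holds @ 9678a579b81e (prover) · by planner
why it might fail: Tree-equivalent to KN Conj 3 (open for its authors beyond |A|=2 / special |A|=3); a gadget family with bimodal N (chains/trees of near-cliques sharing bottlenecks) would refute it; the LINEAR inclusive form is already false on Fin 5 (linearLowerTailInclusive_cex_five).
sources: KozmaNitzan2024, Harris1960, Gladkov2024, AizenmanKestenNewmanCMP1987, VandenbergHaggstromKahn2005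
[crux] ENGINE (sufficient for X by support NoHeavyLowerTailSuffices): for every ε > 0 there is δ > 0
such that on every finite weighted graph, if P(o ↔ A) > 1 − δ and P(a ↔ a′) > 1 − δ for all a, a′ ∈
A, then P(1 ≤ N < (δ/ε)·E N) < ε, where N = |C(o) ∩ A| and E N = Σ_{a∈A} P(o ↔ a). Reason it is the
right residual statement: for fixed b, {o ↔ a} is increasing and {a ↮ b} decreasing, so Harris gives
E[N; o ↮ b] = Σ_a P(o ↔ a, a ↮ b) ≤ δ·E N; hence P(o ↮ b) ≤ P(N = 0) + P(1 ≤ N < t) + δ E N / t for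
every t > 0, and X can fail only through configurations where o meets A but in far fewer points than
average ('pocket with few fingers'). No b appears: the law of N given a (1−δ)-reliable relay set is
the object. Conjecturally the bound is even LINEAR and λ-uniform — P(1 ≤ N < E N/2) ≤ C·(P(o ↮ A) +
max_{a,a′} P(a ↮ a′)) — which is finitely refutable; stars, brooms, chains and trees of near-cliques
give C ≤ 1 (planner's check); refuters should test that form first. [difficulty: L] -/
@[route_item "route-CriticalPhenomena-PercNearOneGluingNoHeavy"]
def NoHeavyLowerTail : Prop :=
  ∀ ε : ℝ, 0 < ε → ∃ δ : ℝ, 0 < δ ∧ ∀ (n : ℕ) (w : Sym2 (Fin n) → unitInterval) (A : Finset (Fin n)) (o : Fin n), 1 - δ < (Literature.Probability.LatticeModels.prodBernoulli w).real (⋃ a ∈ A, Literature.Probability.Percolation.openConn o a) → (∀ a ∈ A, ∀ a' ∈ A, 1 - δ < (Literature.Probability.LatticeModels.prodBernoulli w).real (Literature.Probability.Percolation.openConn a a')) → (Literature.Probability.LatticeModels.prodBernoulli w).real {ω | 1 ≤ (A.filter fun a => ω ∈ Literature.Probability.Percolation.openConn o a).card ∧ ((A.filter fun a => ω ∈ Literature.Probability.Percolation.openConn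 o a).card : ℝ) < δ * (∑ a ∈ A, (Literature.Probability.LatticeModels.prodBernoulli w).real (Literature.Probability.Percolation.openConn o a)) / ε} < ε

/-- item stmt-CriticalPhenomena-4574 · crux · rank 3 · closed · proved by Summit.CriticalPhenomena.PercolationContinuityZ3.Theorems.NearOneGluing_proof @ 2e6c16312cc9 (prover) · by planner
why it might fail: Open even for its authors (KN p.3: Conj 1 'not able to prove or disprove'; only |A|=2 and a special |A|=3 settled); plausible general-graph inequalities fail by gadgets (bunkbed, arXiv:2410.02545); a family with E N ≥ ε/δ and bimodal N refutes it.
sources: KozmaNitzan2024, Literature.Probability.Percolation.KozmaNitzan2024_conjecture3, GladkovPakZimin2024, Gladkov2024, GladkovZimin2024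
[crux] X itself — Kozma–Nitzan Conjecture 3 (arXiv:2401.12397 p.15) over finite weighted graphs
(vertices Fin n, weights w : Sym2 (Fin n) → [0,1], measure prodBernoulli w, events openConn): ∀ ε >
0 ∃ δ > 0 such that P(o ↔ A) > 1 − δ and (∀ a ∈ A, P(a ↔ b) > 1 − δ) imply P(o ↔ b) > 1 − ε. The
whole content is uniformity in |A| (for |A| ≤ k the union bound gives P(o ↮ b) < (k+1)δ). Equivalent
to the uniform-weight-1/2 version (support HalfWeightReduction) and implied by each engine crux
below. [difficulty: open-problem] -/
@[route_item "route-CriticalPhenomena-PercNearOneGluingNoHeavy"]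
def NearOneGluing : Prop :=
  ∀ ε : ℝ, 0 < ε → ∃ δ : ℝ, 0 < δ ∧ ∀ (n : ℕ) (w : Sym2 (Fin n) → unitInterval) (A : Finset (Fin n)) (o b : Fin n), 1 - δ < (Literature.Probability.LatticeModels.prodBernoulli w).real (⋃ a ∈ A, Literature.Probability.Percolation.openConn o a) → (∀ a ∈ A, 1 - δ < (Literature.Probability.LatticeModels.prodBernoulli w).real (Literature.Probability.Percolation.openConn a b)) → 1 - ε < (Literature.Probability.LatticeModels.prodBernoulli w).real (Literature.Probability.Percolation.openConn o b)

/-- item stmt-CriticalPhenomena-20246 · assembly · rank 1 · closed · proved by Summit.CriticalPhenomena.PercolationContinuityZ3.Theorems.percNearOneGluingNoHeavy_assembly_proof @ 4b9a745b4c0a (prover) · by planner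
sources: KozmaNitzan2024, Literature.Probability.Percolation.KozmaNitzan2024_thm6, DuminilCopinSidoraviciusTassion2016, Grimmett1999
[assembly] X decides the conjunct: NearOneGluing → PercolationContinuityZ3 (the sibling's proved
Assembly stmt-CriticalPhenomena-4580 with the proved bridge KNSlabBridge stmt-10357 discharged;
provable now in one line; proved inline in `closes`, not assumed). [difficulty: provable-now] -/
@[route_item "route-CriticalPhenomena-PercNearOneGluingNoHeavy"]
def Assembly : Prop :=
  NearOneGluing → PercolationContinuityZ3

/-! D-0027 §2.1 — DECIDING THEOREM (planner-authored via `route open/edit --closes-file`; by planner-rtask-CriticalPhenomena-PercNearOneG-461c9472-0 2026-08-17T19:20:16Z) — ARCHIVED: route closed (closed) 2026-08-20T12:42:35Z; kept so importers keep building: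
its hypotheses are this route's items and its conclusion the sub-problem Statement (glue_lint), and it elaborates with this file. -/

@[closes "route-CriticalPhenomena-PercNearOneGluingNoHeavy"] theorem closes (h_NoHeavy : NoHeavyLowerTail) : _root_.PercolationContinuityZ3 :=
  -- RGLUE either-engine (2026-08-17): ONE engine is load-bearing in this sibling route — NoHeavyLowerTail (the only
  -- hypothesis). X = NearOneGluing comes from the engine by the sibling's LANDED glue (stmt-CriticalPhenomena-14716,
  -- Theorems.noHeavyLowerTailGlue_proof; the decls here are definitionally the shared ones); the Assembly item
  -- (NearOneGluing → conjunct) is PROVED INLINE from the sibling's landed assembly (stmt-4580,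
  -- Theorems.percNearOneGluing_assembly_proof) and landed bridge KNSlabBridge (stmt-10357, Theorems.KNSlabBridge_proof),
  -- never assumed. The other engine, AdditiveGluing, decides the conjunct through the sibling route PercNearOneGluing.
  have hX : NearOneGluing :=
    _root_.Summit.CriticalPhenomena.PercolationContinuityZ3.Theorems.noHeavyLowerTailGlue_proof h_NoHeavy
  have hA : Assembly := fun hX' =>
    _root_.Summit.CriticalPhenomena.PercolationContinuityZ3.Theorems.percNearOneGluing_assembly_proof
      _root_.Summit.CriticalPhenomena.PercolationContinuityZ3.Theorems.KNSlabBridge_proof hX'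
  hA hX

end Summit.CriticalPhenomena.PercolationContinuityZ3.Theses.PercNearOneGluingNoHeavy
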